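import Literature.MathematicalPhysics.QuantumFieldTheory.Balaban1983to89.T3SmallFibre
import Literature.MathematicalPhysics.QuantumFieldTheory.Balaban1983to89.T3Thresholds
import HarnessLib

/-!
# `Balaban1983to89.T3SmallLiftHistory` — rung R3, crux K1bR-pr (`FluctuationComparisonRegPr`, stub `stub_posOnSmall`):
# the UV-small history of a small datum REDUCED TO A ONE-STEP SMALL LIFT WITH GAIN `κ ≤ L^{-1/2}` (WATCH W7 of the cell, typed)

Cell `ym3-torus` (HUMAN RULING D-0037, YM ladder rung R3), seat `ym3-torus-p2` gen 7; cell record HOME/IR-NODE.md §13 and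
HOME/route-R3/ym/plan-g9/w7/W7-RESULTS.md.

The registered stub `stub_posOnSmall` of `stmt-QuantumFields-19201` asks that for Haar-a.e. `θ(n)`-small datum `V` on the comparison
lattice (`n = ⌊K/m⌋`) BOTH runs' restricted height densities `heightDensity … (histGood K n) V`, `heightDensity … (histGood (K+1) n) V`
are positive.  The densities are Radon–Nikodym versions, so this is NOT bookkeeping (p2 g5 FINDING, 2026-08-26): it needs (i) that every
`θ(n)`-small `V` HAS a fine preimage in Bałaban's UV-small-history event `histGood` — thresholds `θ(K−j)` at height `j` DECREASE towards
the fine lattice, by the factor `θ(i+1)/θ(i) = L^{-1/2}·p(g_{i+1})/p(g_i) ≥ L^{-1/2}` per step (§3) — and (ii) that a fibre meeting the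
(open) event carries positive fibre mass (a submersion / co-area statement about the (0.4) averaging, «Lemma B»).  The tree's exact face
section `T3SmallFibre` / `BlockAveragingSectionPlaq.faceSec` lifts with gain `1` only (`plaqSmall_faceSec_iff`), which does not reach
`L^{-1/2} < 1`.

This module TYPES the two inputs as hypothesis schemas and PROVES the reduction:
* §1 `SmallLiftStep P j ℰ κ δ` — every `δ`-small field on `T^{(j+1)}` is the (0.4) average of a `κδ`-small field on `T^{(j)}` — and the
  ITERATION `exists_preimage_iter_small`: with a height profile `ϑ` satisfying `κ·ϑ(k+1) ≤ ϑ(k)`, a `ϑ(k)`-small field at height `k`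
  has a preimage on the finest lattice all of whose averages are `ϑ`-small (the decreasing-threshold version of
  `T3SmallFibre.exists_small_preimage_iter`); `smallLiftStep_one`: gain `κ = 1` is free (face section).
* §2 `OneStepSmallLift F ℰ κ δ₀` (all runs, all levels, all radii `≤ δ₀`) ⇒ **`exists_mem_fibre_histGood`**: every `θ(n)`-small datum has
  a preimage in `fibre F ℰ n K h V ∩ histGood F ℰ θ K n`, for every threshold profile with `κθ(i) ≤ θ(i+1)`, `θ(i) ≤ δ₀`.
* §3 the threshold ratio: `√(L⁻¹)·θBal(i) ≤ θBal(i+1)` (`p` is antitone in the coupling), hence `κθBal(i) ≤ θBal(i+1)` once `κ√L ≤ 1`.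
* §4 `FibrePositivity` («Lemma B» as a schema: a.e. `V` whose fibre meets the event has positive restricted height density) and the
  assembly **`posOnSmall_of_smallLift`**: `[∀ L, ∃ κ δ₀, κ√L ≤ 1 ∧ δ₀ > 0 ∧ OneStepSmallLift]` ∧ `[FibrePositivity of the histGood events]` ⇒ THE
  REGISTERED SIGNATURE of `stub_posOnSmall` verbatim (∀ L m, 0 < m → ∀ b₀ p₀ …).

STATUS OF THE TWO INPUTS (not proved here; neither is in print — Bałaban never needs surjectivity onto the small-field region):
`OneStepSmallLift` with `κ < L^{-1/2}`: its LINEARISATION (abelian, first order in `δ`) is the finite LP «W7»; CERTIFIED to hold at `L = 3`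
with `κ_lin = 0.4655 < 3^{-1/2} = 0.5774` by an explicit radius-1 translation-invariant lift (plan g9, kit j250598; referee re-derivations
j250718/j250772; this seat's exact-rational certificate kit j251222), and for every odd `L ≥ 5` by the canonical Whitney lift in closed form
`κ_lin ≤ 8L⁴/(L²+1)³ < L^{-1/2}`; the worst coarse pattern needs gain `1/0.45` at `L = 3` (certified lower bound).  The non-linear step
(exp chart + one contraction in Bałaban's small-field chart, `κ = κ_lin + O(δ₀)`) and `FibrePositivity` (co-area for the submersion `avg`)
are the located remaining work.  Elementary; no estimate of Bałaban's is used.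
-/

noncomputable section

open MeasureTheory Filter Topology
open Literature.MathematicalPhysics.QuantumFieldTheory.Balaban1983to89.T3ContinuumYM3Torus
open Literature.MathematicalPhysics.QuantumFieldTheory.Balaban1983to89.T3LevelShift
open Literature.MathematicalPhysics.QuantumFieldTheory.Balaban1983to89.T3UnitLawDensityEML (ℰp measurableE_ℰp)
open Literature.MathematicalPhysics.QuantumFieldTheory.Balaban1983to89.T3UnitScaleTilt
open Literature.MathematicalPhysics.QuantumFieldTheory.Balaban1983to89.T3TiltDescent
open Literature.MathematicalPhysics.QuantumFieldTheory.Balaban1983to89.T3CruxEstimates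
open Literature.MathematicalPhysics.QuantumFieldTheory.Balaban1983to89.T3ConstrainedMinimiser
open Literature.MathematicalPhysics.QuantumFieldTheory.Balaban1983to89.T3DescentFibreTower
open Literature.MathematicalPhysics.QuantumFieldTheory.Balaban1983to89.T3Thresholds
open Literature.MathematicalPhysics.QuantumFieldTheory.Balaban1983to89.T3ThresholdSmallness (sqrt_coupling_pos_le)
open Literature.MathematicalPhysics.QuantumFieldTheory.Balaban1983to89.BlockAveragingSection
open Literature.MathematicalPhysics.QuantumFieldTheory.Balaban1983to89.BlockAveragingSectionPlaq

namespace Literature.MathematicalPhysics.QuantumFieldTheory.Balaban1983to89.T3SmallLiftHistory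

/-! ## §1 One-step small lift with gain `κ`, and its iteration along a decreasing threshold profile -/

section Step

variable {P : Params} {G : Type*} [GaugeGroup G]

/-- **ONE-STEP SMALL LIFT WITH GAIN `κ`** at level `j` (hypothesis schema, never asserted): every `δ`-small configuration `V` on
`T^{(j+1)}` is the (0.4) block average of a `κδ`-small configuration `U` on `T^{(j)}`.  Gain `κ = 1` is the tree's face section
(`smallLiftStep_one`); the route needs `κ ≤ L^{-1/2}`.  NOT PRINTED — Bałaban's papers never require the averaging to map the
small-field region ONTO the coarser small-field region; the objects are those of (0.4)/(0.18). [cite: Balaban1987RG1, (0.4)/(0.18) p.253] -/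
def SmallLiftStep (P : Params) (j : ℕ) (ℰ : LoopAverage G) (κ δ : ℝ) : Prop :=
  ∀ V : GaugeField P (j + 1) G, PlaqSmall δ V →
    ∃ U : GaugeField P j G, (BlockAveraging.blockAvg (P := P) (j := j) ℰ).avg U = V ∧ PlaqSmall (κ * δ) U

/-- Monotonicity of the small-field condition in the radius (local copy of the one-liner). [cite: Balaban1987RG1, (0.18) p.255] -/
private theorem plaqSmall_of_le' {j : ℕ} {δ δ' : ℝ} (hδ : δ ≤ δ') {U : GaugeField P j G} (hU : PlaqSmall δ U) :
    PlaqSmall δ' U :=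
  fun p => (hU p).trans_le hδ

/-- **GAIN `1` IS FREE**: the face section of `BlockAveragingSectionPlaq` is a one-step lift with `κ = 1` (`δ > 0`, standing range,
every `ℰ` with `ℰ(1,…,1) = 1`). [cite: Balaban1987RG1, (0.4)/(0.18) p.253] -/
theorem smallLiftStep_one {j : ℕ} (hj : j + 1 ≤ P.m + P.K) (ℰ : LoopAverage G)
    (hE : ∀ n : ℕ, ℰ.E (fun _ : Fin (n + 1) => (1 : G)) = 1) {δ : ℝ} (hδ : 0 < δ) : SmallLiftStep P j ℰ 1 δ := by
  intro V hV
  obtain ⟨U, hU, hUs⟩ := exists_small_preimage_blockAvg (j := j) hj ℰ hE hδ hV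
  exact ⟨U, hU, by rw [one_mul]; exact hUs⟩

/-- The gain schema is monotone in `κ`. [cite: Balaban1987RG1, (0.4)/(0.18) p.253] -/
theorem SmallLiftStep.mono {j : ℕ} {ℰ : LoopAverage G} {κ κ' δ : ℝ} (hκ : κ ≤ κ') (hδ : 0 ≤ δ)
    (h : SmallLiftStep P j ℰ κ δ) : SmallLiftStep P j ℰ κ' δ := by
  intro V hV
  obtain ⟨U, hU, hUs⟩ := h V hV
  exact ⟨U, hU, plaqSmall_of_le' (mul_le_mul_of_nonneg_right hκ hδ) hUs⟩

/-- **ITERATED SMALL LIFT ALONG A DECREASING PROFILE.**  If every level `j` (standing range) admits one-step lifts with gain `κ` at all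
radii `≤ δ₀`, and the height profile `ϑ` satisfies `0 < ϑ ≤ δ₀` and `κ·ϑ(k+1) ≤ ϑ(k)`, then every `ϑ(k)`-small configuration `W` at
height `k` is `avg^{k} U` for a finest-lattice `U` with `avg^{j} U` `ϑ(j)`-small for all `j ≤ k`.  (Decreasing-threshold twin of
`T3SmallFibre.exists_small_preimage_iter`.) [cite: Balaban1987RG1, (0.4)/(0.11)/(0.18) p.253] -/
theorem exists_preimage_iter_small (ℰ : LoopAverage G) {κ δ₀ : ℝ}
    (hstep : ∀ j : ℕ, j + 1 ≤ P.m + P.K → ∀ δ : ℝ, 0 < δ → δ ≤ δ₀ → SmallLiftStep P j ℰ κ δ)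
    (ϑ : ℕ → ℝ) (hϑpos : ∀ k, 0 < ϑ k) (hϑδ : ∀ k, ϑ k ≤ δ₀) (hϑ : ∀ k, κ * ϑ (k + 1) ≤ ϑ k) :
    ∀ k : ℕ, k ≤ P.m + P.K → ∀ W : GaugeField P k G, PlaqSmall (ϑ k) W →
      ∃ U : GaugeField P 0 G, Averaging.iter (fun i => BlockAveraging.blockAvg (P := P) (j := i) ℰ) k U = W ∧
        ∀ j, j ≤ k → PlaqSmall (ϑ j) (Averaging.iter (fun i => BlockAveraging.blockAvg (P := P) (j := i) ℰ) j U)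
  | 0, _, W, hW => ⟨W, rfl, fun j hj => by
      obtain rfl : j = 0 := Nat.le_zero.mp hj
      exact hW⟩
  | k + 1, hk, W, hW => by
    obtain ⟨W', hW'avg, hW'small⟩ := hstep k hk (ϑ (k + 1)) (hϑpos _) (hϑδ _) W hW
    have hW's : PlaqSmall (ϑ k) W' := plaqSmall_of_le' (hϑ k) hW'small
    obtain ⟨U, hU, hUsmall⟩ := exists_preimage_iter_small ℰ hstep ϑ hϑpos hϑδ hϑ k (by omega) W' hW's
    refine ⟨U, ?_, fun j hj => ?_⟩
    · show (BlockAveraging.blockAvg ℰ).avg (Averaging.iter _ k U) = W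
      rw [hU, hW'avg]
    · rcases Nat.lt_or_ge j (k + 1) with hlt | hge
      · exact hUsmall j (by omega)
      · obtain rfl : j = k + 1 := le_antisymm hj hge
        show PlaqSmall (ϑ (k + 1)) ((BlockAveraging.blockAvg ℰ).avg (Averaging.iter _ k U))
        rw [hU, hW'avg]
        exact hW

end Step

/-! ## §2 The family: a small datum has a UV-small history -/

section Family

variable (F : T3Family) {G : Type*} [GaugeGroup G] (ℰ : LoopAverage G)

/-- **ONE-STEP SMALL LIFT FOR THE WHOLE FAMILY** (hypothesis schema, never asserted): every run `K`, every level `j` in the standing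
range `j + 1 ≤ m + K`, every radius `δ ∈ (0, δ₀]` admits one-step (0.4) lifts with gain `κ`.  The route needs it with `κ√L ≤ 1`
(WATCH W7: its linearisation is certified at `L = 3` with `κ_lin = 0.4655`, and holds for odd `L ≥ 5` with `κ_lin ≤ 8L⁴/(L²+1)³`).
NOT PRINTED. [cite: Balaban1987RG1, (0.4)/(0.18) p.253] -/
def OneStepSmallLift (κ δ₀ : ℝ) : Prop :=
  ∀ K j : ℕ, j + 1 ≤ (F.P K).m + (F.P K).K → ∀ δ : ℝ, 0 < δ → δ ≤ δ₀ → SmallLiftStep (F.P K) j ℰ κ δ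

/-- Gain `1` for the whole family (face sections), any `δ₀`. [cite: Balaban1987RG1, (0.4)/(0.18) p.253] -/
theorem oneStepSmallLift_one (hE : ∀ n : ℕ, ℰ.E (fun _ : Fin (n + 1) => (1 : G)) = 1) (δ₀ : ℝ) :
    OneStepSmallLift F ℰ 1 δ₀ :=
  fun K _ hj _ hδ _ => smallLiftStep_one (P := F.P K) hj ℰ hE hδ

/-- **EVERY SMALL DATUM HAS A UV-SMALL HISTORY.**  Under `OneStepSmallLift F ℰ κ δ₀` (`κ ≤ 1`) and a threshold profile `θ` with
`0 < θ ≤ δ₀` and `κθ(i) ≤ θ(i+1)`: every `θ(n)`-small datum `V` of the `n`-th approximation has, for every `K ≥ n`, a preimage `U` of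
run `K` in its descent fibre (`D_{n,K}U = V`) lying in Bałaban's UV-small-history event `histGood F ℰ θ K n` (all averages `avg^{j}U`,
`j + n ≤ K`, `θ(K−j)`-small).  This is input (i) of `stub_posOnSmall`. [cite: Balaban1985UV3, (7) p.257] -/
theorem exists_mem_fibre_histGood {κ δ₀ : ℝ} (hlift : OneStepSmallLift F ℰ κ δ₀) (hκ1 : κ ≤ 1)
    {θ : ℕ → ℝ} (hθpos : ∀ i, 0 < θ i) (hθδ : ∀ i, θ i ≤ δ₀) (hθ : ∀ i, κ * θ i ≤ θ (i + 1))
    {n K : ℕ} (h : n ≤ K) {V : GaugeField (F.P n) 0 G} (hV : PlaqSmall (θ n) V) :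
    ∃ U ∈ fibre F ℰ n K h V, U ∈ histGood F ℰ θ K n := by
  -- thresholds by HEIGHT in run `K`: `ϑ k = θ (K − k)`
  have hϑ : ∀ k, κ * θ (K - (k + 1)) ≤ θ (K - k) := by
    intro k
    by_cases hk : k + 1 ≤ K
    · have : K - k = (K - (k + 1)) + 1 := by omega
      rw [this]
      exact hθ _
    · have h1 : K - (k + 1) = 0 := by omega
      have h2 : K - k = 0 := by omega
      rw [h1, h2]
      exact mul_le_of_le_one_left (hθpos 0).le hκ1
  have hk : K - n ≤ (F.PP F.m K).m + (F.PP F.m K).K := by show K - n ≤ F.m + K; omega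
  have hV' : PlaqSmall (θ (K - (K - n))) (fieldShift (F.sitesPerDir_eq (m := F.m) (K := K) (j := K - n) (m' := F.m)
      (K' := n) (j' := 0) (by omega)) V) := fun p => by
    rw [plaqHol_fieldShift, show K - (K - n) = n by omega]; exact hV _
  obtain ⟨U, hU, hUsmall⟩ := exists_preimage_iter_small (P := F.PP F.m K) ℰ (fun j hj δ hδ hδ' => hlift K j hj δ hδ hδ')
    (fun k => θ (K - k)) (fun k => hθpos _) (fun k => hθδ _) hϑ (K - n) hk _ hV'
  refine ⟨U, ?_, fun j hj => hUsmall j (by omega)⟩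
  show fieldShift _ (Averaging.iter (fun i => BlockAveraging.blockAvg (P := F.PP F.m K) (j := i) ℰ) (K - n) U) = V
  rw [hU, fieldShift_fieldShift]
  exact fieldShift_refl _ _

end Family

/-! ## §3 The threshold ratio: one step down costs at most the factor `√L` -/

section Ratio

variable {L : ℕ} {γ b₀ p₀ : ℝ}

/-- `p(g) = b₀(1 + log g⁻¹)^{p₀}` is ANTITONE in the coupling on `(0, 1]` (`b₀, p₀ ≥ 0`). [cite: Balaban1985UV3, (7) p.257] -/
theorem pFun_le_pFun_of_le (hb : 0 ≤ b₀) (hp : 0 ≤ p₀) {g g' : ℝ} (hg : 0 < g) (hgg' : g ≤ g') (hg'1 : g' ≤ 1) :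
    B10.pFun b₀ p₀ g' ≤ B10.pFun b₀ p₀ g := by
  unfold B10.pFun
  have hg' : 0 < g' := hg.trans_le hgg'
  have hlog' : 0 ≤ Real.log g'⁻¹ := Real.log_nonneg ((one_le_inv₀ hg').mpr hg'1)
  have hle : Real.log g'⁻¹ ≤ Real.log g⁻¹ := Real.log_le_log (inv_pos.mpr hg') (inv_anti₀ hg hgg')
  exact mul_le_mul_of_nonneg_left (Real.rpow_le_rpow (by linarith) (by linarith) hp) hb

/-- **`√(L⁻¹)·θ(i) ≤ θ(i+1)`**: `θ(i+1)/θ(i) = L^{-1/2}·p(g_{i+1})/p(g_i) ≥ L^{-1/2}` (`0 < γ ≤ 1`, `L ≥ 1`, `b₀, p₀ ≥ 0`) — the ratio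
a one-step lift must beat. [cite: Balaban1985UV3, (3) p.256 and (7) p.257] -/
theorem sqrt_inv_mul_θBal_le_succ (hL : 1 ≤ L) (hγ : 0 < γ) (hγ1 : γ ≤ 1) (hb : 0 ≤ b₀) (hp : 0 ≤ p₀) (i : ℕ) :
    Real.sqrt ((L : ℝ)⁻¹) * θBal L γ b₀ p₀ i ≤ θBal L γ b₀ p₀ (i + 1) := by
  rw [θBal_eq, θBal_eq]
  have hLinv : 0 ≤ ((L : ℝ)⁻¹) := inv_nonneg.mpr (Nat.cast_nonneg L)
  have hgi := sqrt_coupling_pos_le hL hγ i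
  have hgi1 : Real.sqrt (γ * ((L : ℝ)⁻¹) ^ i) ≤ 1 := coupling_le_one hL hγ hγ1 i
  have hsucc : Real.sqrt (γ * ((L : ℝ)⁻¹) ^ (i + 1)) = Real.sqrt ((L : ℝ)⁻¹) * Real.sqrt (γ * ((L : ℝ)⁻¹) ^ i) := by
    rw [← Real.sqrt_mul hLinv]
    congr 1
    ring
  have hle : Real.sqrt (γ * ((L : ℝ)⁻¹) ^ (i + 1)) ≤ Real.sqrt (γ * ((L : ℝ)⁻¹) ^ i) := coupling_succ_le hL hγ.le i
  have hpos' : 0 < Real.sqrt (γ * ((L : ℝ)⁻¹) ^ (i + 1)) := (sqrt_coupling_pos_le hL hγ (i + 1)).1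
  have hp_le : B10.pFun b₀ p₀ (Real.sqrt (γ * ((L : ℝ)⁻¹) ^ i)) ≤ B10.pFun b₀ p₀ (Real.sqrt (γ * ((L : ℝ)⁻¹) ^ (i + 1))) :=
    pFun_le_pFun_of_le hb hp hpos' hle hgi1
  calc Real.sqrt ((L : ℝ)⁻¹) * (Real.sqrt (γ * ((L : ℝ)⁻¹) ^ i) * B10.pFun b₀ p₀ (Real.sqrt (γ * ((L : ℝ)⁻¹) ^ i)))
      = Real.sqrt (γ * ((L : ℝ)⁻¹) ^ (i + 1)) * B10.pFun b₀ p₀ (Real.sqrt (γ * ((L : ℝ)⁻¹) ^ i)) := by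
        rw [hsucc]; ring
    _ ≤ Real.sqrt (γ * ((L : ℝ)⁻¹) ^ (i + 1)) * B10.pFun b₀ p₀ (Real.sqrt (γ * ((L : ℝ)⁻¹) ^ (i + 1))) :=
        mul_le_mul_of_nonneg_left hp_le hpos'.le

/-- **A GAIN `κ` WITH `κ√L ≤ 1` BEATS THE THRESHOLD RATIO**: `κ·θ(i) ≤ θ(i+1)` for all `i`. [cite: Balaban1985UV3, (3) p.256 and (7) p.257] -/
theorem mul_θBal_le_θBal_succ (hL : 1 ≤ L) (hγ : 0 < γ) (hγ1 : γ ≤ 1) (hb : 0 ≤ b₀) (hp : 0 ≤ p₀) {κ : ℝ}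
    (hκ : κ * Real.sqrt L ≤ 1) (i : ℕ) : κ * θBal L γ b₀ p₀ i ≤ θBal L γ b₀ p₀ (i + 1) := by
  have hL' : (0 : ℝ) < Real.sqrt L := Real.sqrt_pos.mpr (by exact_mod_cast hL)
  have hκ' : κ ≤ Real.sqrt ((L : ℝ)⁻¹) := by
    rw [Real.sqrt_inv, ← one_div]
    exact (le_div_iff₀ hL').mpr hκ
  have hθ0 : 0 ≤ θBal L γ b₀ p₀ i := by
    rw [θBal_eq]
    exact mul_nonneg (Real.sqrt_nonneg _)
      (B10.pFun_nonneg b₀ p₀ _ hb (sqrt_coupling_pos_le hL hγ i).1 (coupling_le_one hL hγ hγ1 i))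
  exact (mul_le_mul_of_nonneg_right hκ' hθ0).trans (sqrt_inv_mul_θBal_le_succ hL hγ hγ1 hb hp i)

end Ratio

/-! ## §4 «Lemma B» as a schema, and the assembly to the registered signature of `stub_posOnSmall` -/

section Assembly

variable (F : T3Family) (γ : ℝ)

/-- **FIBRE POSITIVITY** («Lemma B», hypothesis schema, never asserted): for Haar-a.e. datum `V` of the `n`-th approximation whose
descent fibre in run `K` MEETS the event `S`, the restricted height density `heightDensity F γ h S V` (Bałaban's
`T_{K−n−1}⋯T_0(1_S e^{−β_K A})` read at `V`) is positive.  For the open events `histGood` this is the co-area / submersion property of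
the (0.4) averaging with the positivity of the Gibbs weight; measure theory about (2) p.256, NOT PRINTED. [cite: Balaban1985UV3, (2) p.256 and (41) p.266] -/
def FibrePositivity {n K : ℕ} (h : n ≤ K) (S : Set (GaugeField (F.P K) 0 (Matrix.specialUnitaryGroup (Fin 2) ℂ))) : Prop :=
  ∀ᵐ V ∂fieldMeasure (F.P n) 0 (Matrix.specialUnitaryGroup (Fin 2) ℂ),
    (∃ U ∈ fibre F ℰp n K h V, U ∈ S) → 0 < heightDensity F γ h S V

variable {F γ}

/-- **ONE CUT-OFF**: small lift with `κ√L ≤ 1` at radii `≤ δ₀`, thresholds `θBal ≤ δ₀`, and fibre positivity of the two runs' history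
events ⇒ the `K`-th clause of `stub_posOnSmall` (both restricted height densities positive a.e. on the `θ(⌊K/m⌋)`-small region).
[cite: Balaban1985UV3, (7) p.257 and (41) p.266] -/
theorem posOnSmall_clause_of_smallLift {κ δ₀ b₀ p₀ : ℝ} (hlift : OneStepSmallLift F ℰp κ δ₀)
    (hκ : κ * Real.sqrt F.L ≤ 1) (hγ : 0 < γ) (hγ1 : γ ≤ 1) (hb : 0 < b₀) (hp : 0 ≤ p₀)
    (hθδ : ∀ i, θBal F.L γ b₀ p₀ i ≤ δ₀) (m K : ℕ)
    (h₀ : FibrePositivity F γ (Nat.div_le_self K m) (histGood F ℰp (θBal F.L γ b₀ p₀) K (K / m)))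
    (h₁ : FibrePositivity F γ ((Nat.div_le_self K m).trans (Nat.le_succ K))
      (histGood F ℰp (θBal F.L γ b₀ p₀) (K + 1) (K / m))) :
    ∀ᵐ V ∂fieldMeasure (F.P (K / m)) 0 (Matrix.specialUnitaryGroup (Fin 2) ℂ),
      PlaqSmall (θBal F.L γ b₀ p₀ (K / m)) V →
        0 < heightDensity F γ (Nat.div_le_self K m) (histGood F ℰp (θBal F.L γ b₀ p₀) K (K / m)) V ∧
        0 < heightDensity F γ ((Nat.div_le_self K m).trans (Nat.le_succ K))
          (histGood F ℰp (θBal F.L γ b₀ p₀) (K + 1) (K / m)) V := by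
  have hL : 1 ≤ F.L := F.hL.2.le
  have hκ1 : κ ≤ 1 := by
    rcases le_or_gt κ 0 with hκ0 | hκ0
    · linarith
    · have h1 : (1 : ℝ) ≤ Real.sqrt F.L := by
        rw [show (1 : ℝ) = Real.sqrt 1 from Real.sqrt_one.symm]
        exact Real.sqrt_le_sqrt (by exact_mod_cast hL)
      have h2 := mul_le_mul_of_nonneg_left h1 hκ0.le
      rw [mul_one] at h2
      exact h2.trans hκ
  have hθpos : ∀ i, 0 < θBal F.L γ b₀ p₀ i := fun i => T3MinimiserStabilityReduction.θBal_pos hL hγ hγ1 hb p₀ i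
  have hθ : ∀ i, κ * θBal F.L γ b₀ p₀ i ≤ θBal F.L γ b₀ p₀ (i + 1) :=
    mul_θBal_le_θBal_succ hL hγ hγ1 hb.le hp hκ
  filter_upwards [h₀, h₁] with V hV₀ hV₁ hV
  exact ⟨hV₀ (exists_mem_fibre_histGood F ℰp hlift hκ1 hθpos hθδ hθ _ hV),
    hV₁ (exists_mem_fibre_histGood F ℰp hlift hκ1 hθpos hθδ hθ _ hV)⟩

/-- **`stub_posOnSmall` ⇐ ONE-STEP SMALL LIFT (gain `κ√L ≤ 1`) ∧ FIBRE POSITIVITY** — the registered signature of the stub of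
`stmt-QuantumFields-19201`, VERBATIM, from the two schemas: for every block size `L` a gain `κ` with `κ√L ≤ 1` and a radius `δ₀ > 0`
such that every family with `F.L = L` has one-step lifts at radii `≤ δ₀` (WATCH W7: linearisation certified), and fibre positivity of
the UV-small-history events of all runs.  The coupling threshold `γ₁` is the one below which all of Bałaban's thresholds are `≤ δ₀`
(`T3Thresholds.exists_gamma_forall_θBal_le`). [cite: Balaban1985UV3, (7) p.257 and (41) p.266] -/
theorem posOnSmall_of_smallLift
    (hlift : ∀ L : ℕ, ∃ κ δ₀ : ℝ, κ * Real.sqrt L ≤ 1 ∧ 0 < δ₀ ∧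
      ∀ F : T3Family, F.L = L → OneStepSmallLift F ℰp κ δ₀)
    (hpos : ∀ (F : T3Family) (γ b₀ p₀ : ℝ) (n K : ℕ) (h : n ≤ K),
      FibrePositivity F γ h (histGood F ℰp (θBal F.L γ b₀ p₀) K n)) :
    ∀ (L m : ℕ), 0 < m → ∀ (b₀ p₀ : ℝ), 0 < b₀ → 2 < p₀ → ∃ γ₁ : ℝ, 0 < γ₁ ∧ ∀ (F : T3Family) (γ : ℝ), F.L = L →
      0 < γ → γ ≤ γ₁ → ∀ K, ∀ᵐ V ∂fieldMeasure (F.P (K / m)) 0 (Matrix.specialUnitaryGroup (Fin 2) ℂ),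
        PlaqSmall (θBal F.L γ b₀ p₀ (K / m)) V →
          0 < heightDensity F γ (Nat.div_le_self K m) (histGood F ℰp (θBal F.L γ b₀ p₀) K (K / m)) V ∧
          0 < heightDensity F γ ((Nat.div_le_self K m).trans (Nat.le_succ K))
            (histGood F ℰp (θBal F.L γ b₀ p₀) (K + 1) (K / m)) V := by
  intro L m _ b₀ p₀ hb hp
  obtain ⟨κ, δ₀, hκ, hδ₀, hF⟩ := hlift L
  obtain ⟨γ₁, hγ₁, hγ₁1, hθ⟩ := exists_gamma_forall_θBal_le (b₀ := b₀) (p₀ := p₀) hb (by linarith) hδ₀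
  refine ⟨γ₁, hγ₁, fun F γ hFL hγ hγγ₁ K => ?_⟩
  have hL : 1 ≤ F.L := F.hL.2.le
  subst hFL
  exact posOnSmall_clause_of_smallLift (hF F rfl) hκ hγ (hγγ₁.trans hγ₁1) hb (by linarith)
    (fun i => hθ F.L hL γ hγ hγγ₁ i) m K (hpos F γ b₀ p₀ _ _ _) (hpos F γ b₀ p₀ _ _ _)

end Assembly

end Literature.MathematicalPhysics.QuantumFieldTheory.Balaban1983to89.T3SmallLiftHistory

end
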